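/-
Copyright: the b2b-balaban T⁴-continuum CRUX team, row NE7b OWNER lineage `t4-ne7b-p1` (gen 124). Project licence.
-/
import Summits.QuantumFields.BalabanUV.T4Continuum.Spine.NE7b.SupZdPerturbedColumn
import Summits.QuantumFields.BalabanUV.T4Continuum.Spine.NE7b.SupZdGreenIdentity

/-!
# THE PERTURBED NEXT-SCALE HESSIAN IS SYMMETRIC WHEN THE NONLOCAL PART IS: with (222)'s objects and merged constants (all clauses
# re-exported), if `K(p,q) = K(q,p)` then `T_K(b,c) = T_K(c,b)` (Green's identity (231) for the pair of decaying block columns `Ψ^K_b, Ψ^K_c`)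
# and `N_K(b,c) = N_K(c,b)` (`N_Kᵗ` is a decaying left inverse of `T_K = T_Kᵗ`; (222)'s uniqueness) — so `(n+1)^dN_K` is a symmetric form,
# as a Hessian must be (row NE7b, node U5c; (222)∕(231) BY NAME; [folklore])

Cell `pub-balaban`, sub-cell `t4`, spine estimate NE7b (`T4WeightBudget.RelWeightBound`; the cell's OWN estimate — NOT PRINTED in
[Bałaban 1983–89], NOT PROVED).  Crux-route work under `Spine/NE7b/` by the row OWNER (`t4-ne7b-p1` gen 124, file (232)) under FREEZE
(0)'s crux-prover clause; NOTHING of Bałaban's is named as a Lean object, valued or asserted; no `T4Continuum/Support` leaf typed; no `def`,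
no notation; zero `sorry`.  Imports (BY NAME): the OWNER's (222) `…SupZdPerturbedColumn` (`zd_perturbed_column`, `K_pos`), (231)
`…SupZdGreenIdentity` (`green_identity`), (191) `natAbs_sub_comm_sum`, (27) `mem_B`; Mathlib's `hasSum_sum_of_ne_finset_zero`.

WHY (located).  The sup road never used symmetry of `K`, so (216)–(230) state nothing about it; but the quadratic form of the next-scale
action is `(n+1)^d⟨φ, N_Kφ⟩`, and both (166)'s floor pattern and any Gaussian-measure reading need `N_K` symmetric.  With `u = Ψ^K_b`, `w =
Ψ^K_c` (block profiles `2C_PK_{δ₀−μ}` by (222) (A)), (231) gives `Σ′_pΨ^K_b(H_V+K)Ψ^K_c = Σ′_pΨ^K_c(H_V+K)Ψ^K_b`, i.e. `Σ_{B n c}Ψ^K_b =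
Σ_{B n b}Ψ^K_c` (the block equations turn both sides into finite block sums) — `T_K` is symmetric; then `Σ′_{b′}N_K(b′,b)T_K(b′,c) =
Σ′_{b′}T_K(c,b′)N_K(b′,b) = δ_{cb}`, so `N_Kᵗ` is a decaying left inverse of `T_K` and (222) (C)'s uniqueness gives `N_Kᵗ = N_K`.

WHAT IS PROVED ([folklore]): §1 **`zd_perturbed_symmetric`** (THE END: `∃ C₀ C_P δ₀ c₁ δ₁ > 0`: for ALL data as in (222) and SYMMETRIC
`K`: `∃ Ψ Ψ^K M N` with ALL clauses of (222) AND (D): `T_K` symmetric, `N_K` symmetric); §2 toy.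

HONEST (what this is NOT).  Symmetry only — no positivity ∕ floor for `T_K` or `N_K` on `ℓ²(ℤ^d)` (the natural sequel: `⟨g,T_Kg⟩ ≥ γ‖g‖²`
from (231) + (216)), no torus statement; nothing of the covariant propagators of [B4]–[B6]; nothing of Bałaban's asserted.  BY-NAME EFFECT
ON THE WALL: NONE.  NE7b NOT PRINTED ∕ NOT PROVED; spine PROVED 0∕9; rung (B)+1 — the programme's measures remain FINITE-torus statements; NOT
the mass gap, NOT Clay.  HONEST DEPENDENCY: continuum YM on T⁴ ⇐ BetaPertH ∧ nine spine estimates (0∕9 proved); BetaPertH ⇐ (D1) ∧ (D4) ∧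
CAP+tail; G-an2-4 gates asym, D1 and NE2∕3∕4.
-/

set_option autoImplicit false

noncomputable section

namespace Summit.QuantumFields.BalabanUV.T4Continuum.NE7b.SupZdPerturbedSymmetric

open Real Filter Topology
open scoped ENNReal
open Literature.MathematicalPhysics.QuantumFieldTheory.Balaban1983to89
open B6QGQLower276 (X e blk B mem_B)
open SupZdCoarseForm (natAbs_sub_comm_sum)
open SupZdPerturbedColumn (K_pos zd_perturbed_column)
open SupZdGreenIdentity (green_identity)

variable {d : ℕ}

/-! ## §1. THE END: for a symmetric nonlocal part the perturbed next-scale Hessian is a symmetric kernel -/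

/-- **HEADLINE — SYMMETRY OF `T_K` AND `N_K` FOR SYMMETRIC `K`**: with the constants, hypotheses and ALL clauses of (222) (re-exported), if
moreover `K(p,q) = K(q,p)`, then the perturbed coarse operator is symmetric, `T_K(b,c) = T_K(c,b)`, and so is its inverse, `N_K(b,c) = N_K(c,b)`
— Green's identity on `ℤ^d` ((231)) for the pair `(Ψ^K_b, Ψ^K_c)` of decaying block columns gives `Σ_{B n c}Ψ^K_b = Σ_{B n b}Ψ^K_c`; then
`N_Kᵗ` is a decaying LEFT inverse of `T_K = T_Kᵗ` and (222)'s uniqueness identifies it with `N_K`.  So `(n+1)^dN_K` IS a Hessian (a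
symmetric form) whenever the nonlocal part is. [folklore] -/
theorem zd_perturbed_symmetric (hd : 3 ≤ d) (a : ℝ) (ha : 0 < a) {lam Lam : ℝ} (hlam : lam < min 2 a) (hLam : 0 ≤ Lam) :
    ∃ C₀ CP δ₀ c₁ δ₁ : ℝ, 0 < C₀ ∧ 0 < CP ∧ 0 < δ₀ ∧ 0 < c₁ ∧ 0 < δ₁ ∧
    ∀ (n : ℕ) (V : X d → ℝ), (∀ p, -lam ≤ V p) → (∀ p, V p ≤ Lam) →
    ∀ (ε γ μ ν : ℝ), 0 ≤ ε → 0 < μ → μ < δ₀ → μ < γ → 0 < ν → ν < μ → ν < δ₁ →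
      ε * (2 * (1 - exp (-γ))⁻¹) ^ d * C₀ ≤ 1 / 2 →
      (CP * (2 * (1 - exp (-(δ₀ - μ)))⁻¹) ^ d) * (ε * exp (μ * d) * (2 * (1 - exp (-(γ - μ)))⁻¹) ^ d) ≤ 1 / 2 →
      (c₁ * exp (ν * d) * (2 * (1 - exp (-(δ₁ - ν)))⁻¹) ^ d)
        * ((4 * (CP * (2 * (1 - exp (-(δ₀ - μ)))⁻¹) ^ d)
            * ((CP * (2 * (1 - exp (-(δ₀ - μ)))⁻¹) ^ d) * (ε * exp (μ * d) * (2 * (1 - exp (-(γ - μ)))⁻¹) ^ d)))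
          * exp (ν * d) * (2 * (1 - exp (-(μ - ν)))⁻¹) ^ d) ≤ 1 / 2 →
    ∀ (K : X d → X d → ℝ), (∀ p q, |K p q| ≤ ε * exp (-(γ * ∑ i, (((p i - q i).natAbs : ℕ) : ℝ)))) →
      (∀ p q, K p q = K q p) →
    ∃ Ψ ΨK M N : X d → X d → ℝ,
      -- (A) the block columns
      (∀ c p, ((n : ℝ) + 1) ^ 2 * ∑ μ', (2 * Ψ c p - Ψ c (p + e μ') - Ψ c (p - e μ'))
        + a / ((n : ℝ) + 1) ^ d * ∑ q ∈ B n (blk n p), Ψ c q + V p * Ψ c p = if blk n p = c then 1 else 0) ∧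
      (∀ c p, |Ψ c p| ≤ 2 * (CP * (2 * (1 - exp (-(δ₀ - μ)))⁻¹) ^ d) * exp (-(μ * ∑ i, (((blk n p i - c i).natAbs : ℕ) : ℝ)))) ∧
      (∀ c p, ((n : ℝ) + 1) ^ 2 * ∑ μ', (2 * ΨK c p - ΨK c (p + e μ') - ΨK c (p - e μ'))
        + a / ((n : ℝ) + 1) ^ d * ∑ q ∈ B n (blk n p), ΨK c q + V p * ΨK c p + ∑' q : X d, K p q * ΨK c q
          = if blk n p = c then 1 else 0) ∧
      (∀ c p, |ΨK c p| ≤ 2 * (CP * (2 * (1 - exp (-(δ₀ - μ)))⁻¹) ^ d) * exp (-(μ * ∑ i, (((blk n p i - c i).natAbs : ℕ) : ℝ)))) ∧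
      (∀ c p, |ΨK c p - Ψ c p| ≤ 4 * (CP * (2 * (1 - exp (-(δ₀ - μ)))⁻¹) ^ d)
        * ((CP * (2 * (1 - exp (-(δ₀ - μ)))⁻¹) ^ d) * (ε * exp (μ * d) * (2 * (1 - exp (-(γ - μ)))⁻¹) ^ d))
        * exp (-(μ * ∑ i, (((blk n p i - c i).natAbs : ℕ) : ℝ)))) ∧
      (∀ b c, |(((n : ℝ) + 1) ^ d)⁻¹ * ∑ q ∈ B n b, ΨK c q - (((n : ℝ) + 1) ^ d)⁻¹ * ∑ q ∈ B n b, Ψ c q|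
        ≤ 4 * (CP * (2 * (1 - exp (-(δ₀ - μ)))⁻¹) ^ d)
          * ((CP * (2 * (1 - exp (-(δ₀ - μ)))⁻¹) ^ d) * (ε * exp (μ * d) * (2 * (1 - exp (-(γ - μ)))⁻¹) ^ d))
          * exp (-(μ * ∑ i, (((b i - c i).natAbs : ℕ) : ℝ)))) ∧
      -- (B) the inverse of the coarse operator
      (∀ b b' : X d, Tendsto (fun R : ℕ =>
        if h : b ∈ (Fintype.piFinset fun _ : Fin d => Finset.Icc (-(R : ℤ)) R) ∧
            b' ∈ (Fintype.piFinset fun _ : Fin d => Finset.Icc (-(R : ℤ)) R)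
          then (Matrix.of fun c c' : ↥(Fintype.piFinset fun _ : Fin d => Finset.Icc (-(R : ℤ)) R) =>
            (((n : ℝ) + 1) ^ d)⁻¹ * ∑ q ∈ B n (c : X d), Ψ (c' : X d) q)⁻¹ ⟨b, h.1⟩ ⟨b', h.2⟩ else 0)
        atTop (𝓝 (M b b'))) ∧
      (∀ b c, |M b c| ≤ c₁ * exp (-(δ₁ * ∑ i, (((b i - c i).natAbs : ℕ) : ℝ)))) ∧
      (∀ b c, M b c = M c b) ∧
      (∀ b c, ∑' b' : X d, ((((n : ℝ) + 1) ^ d)⁻¹ * ∑ q ∈ B n b, Ψ b' q) * M b' c = if b = c then 1 else 0) ∧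
      (∀ b c, ∑' b' : X d, M b b' * ((((n : ℝ) + 1) ^ d)⁻¹ * ∑ q ∈ B n b', Ψ c q) = if b = c then 1 else 0) ∧
      -- (C) the inverse of the perturbed coarse operator
      (∀ b c, |N b c| ≤ 2 * (c₁ * exp (ν * d) * (2 * (1 - exp (-(δ₁ - ν)))⁻¹) ^ d) * exp (-(ν * ∑ i, (((b i - c i).natAbs : ℕ) : ℝ)))) ∧
      (∀ b c, Summable (fun b' : X d => ((((n : ℝ) + 1) ^ d)⁻¹ * ∑ q ∈ B n b, ΨK b' q) * N b' c) ∧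
        ∑' b' : X d, ((((n : ℝ) + 1) ^ d)⁻¹ * ∑ q ∈ B n b, ΨK b' q) * N b' c = if b = c then 1 else 0) ∧
      (∀ b c, Summable (fun b' : X d => N b b' * ((((n : ℝ) + 1) ^ d)⁻¹ * ∑ q ∈ B n b', ΨK c q)) ∧
        ∑' b' : X d, N b b' * ((((n : ℝ) + 1) ^ d)⁻¹ * ∑ q ∈ B n b', ΨK c q) = if b = c then 1 else 0) ∧
      (∀ b c, |N b c - M b c| ≤ 2 * (c₁ * exp (ν * d) * (2 * (1 - exp (-(δ₁ - ν)))⁻¹) ^ d)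
        * ((c₁ * exp (ν * d) * (2 * (1 - exp (-(δ₁ - ν)))⁻¹) ^ d)
          * ((4 * (CP * (2 * (1 - exp (-(δ₀ - μ)))⁻¹) ^ d)
              * ((CP * (2 * (1 - exp (-(δ₀ - μ)))⁻¹) ^ d) * (ε * exp (μ * d) * (2 * (1 - exp (-(γ - μ)))⁻¹) ^ d)))
            * exp (ν * d) * (2 * (1 - exp (-(μ - ν)))⁻¹) ^ d))
        * exp (-(ν * ∑ i, (((b i - c i).natAbs : ℕ) : ℝ)))) ∧
      (∀ (N' : X d → X d → ℝ) (C' ν' : ℝ), 0 ≤ C' → 0 < ν' →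
        (∀ b c, |N' b c| ≤ C' * exp (-(ν' * ∑ i, (((b i - c i).natAbs : ℕ) : ℝ)))) →
        ((∀ b c, ∑' b' : X d, ((((n : ℝ) + 1) ^ d)⁻¹ * ∑ q ∈ B n b, ΨK b' q) * N' b' c = if b = c then 1 else 0) →
          ∀ b c, N' b c = N b c) ∧
        ((∀ b c, ∑' b' : X d, N' b b' * ((((n : ℝ) + 1) ^ d)⁻¹ * ∑ q ∈ B n b', ΨK c q) = if b = c then 1 else 0) →
          ∀ b c, N' b c = N b c)) ∧
      -- (D) SYMMETRY for a symmetric `K`: the perturbed coarse operator and its inverse are symmetric kernels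
      (∀ b c, (((n : ℝ) + 1) ^ d)⁻¹ * ∑ q ∈ B n b, ΨK c q = (((n : ℝ) + 1) ^ d)⁻¹ * ∑ q ∈ B n c, ΨK b q) ∧
      (∀ b c, N b c = N c b) := by
  classical
  obtain ⟨C₀, CP, δ₀, c₁, δ₁, hC₀, hCP, hδ₀, hc₁, hδ₁, H222⟩ := zd_perturbed_column (d := d) hd a ha hlam hLam
  refine ⟨C₀, CP, δ₀, c₁, δ₁, hC₀, hCP, hδ₀, hc₁, hδ₁, ?_⟩
  intro n V hV hV' ε γ μ ν hε hμ hμδ hμγ hν hνμ hνδ hsmall1 hsmall2 hsmall3 K hK hKs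
  obtain ⟨Ψ, ΨK, M, N, hA1, hA2, hA3, hA4, hA5, hA6, hB1, hB2, hB3, hB4, hB5, hC1, hC2, hC3, hC4, hC5⟩ :=
    H222 n V hV hV' ε γ μ ν hε hμ hμδ hμγ hν hνμ hνδ hsmall1 hsmall2 hsmall3 K hK
  have hγ : 0 < γ := hμ.trans hμγ
  have hvol : (0 : ℝ) < ((n : ℝ) + 1) ^ d := by positivity
  -- `V` is bounded
  have hVb : ∀ p, |V p| ≤ |lam| + |Lam| := fun p =>
    abs_le.2 ⟨by linarith [hV p, le_abs_self lam, abs_nonneg Lam], by linarith [hV' p, le_abs_self Lam, abs_nonneg lam]⟩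
  -- `T_K` is symmetric: Green's identity for `(Ψ^K_b, Ψ^K_c)`
  have hind : ∀ (c : X d) (u : X d → ℝ), ∑' p : X d, u p * (if blk n p = c then (1 : ℝ) else 0) = ∑ p ∈ B n c, u p := by
    intro c u
    have h : ∀ p ∉ B n c, u p * (if blk n p = c then (1 : ℝ) else 0) = 0 := fun p hp => by
      rw [if_neg (fun h' => hp (mem_B.2 h')), mul_zero]
    have hs : HasSum (fun p => u p * (if blk n p = c then (1 : ℝ) else 0)) (∑ p ∈ B n c, u p * (if blk n p = c then (1 : ℝ) else 0)) :=
      hasSum_sum_of_ne_finset_zero h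
    rw [hs.tsum_eq]
    exact Finset.sum_congr rfl fun p hp => by rw [if_pos (mem_B.1 hp), mul_one]
  have hTsym : ∀ b c, (((n : ℝ) + 1) ^ d)⁻¹ * ∑ q ∈ B n b, ΨK c q = (((n : ℝ) + 1) ^ d)⁻¹ * ∑ q ∈ B n c, ΨK b q := by
    intro b c
    obtain ⟨-, hG⟩ := green_identity (d := d) n a hμ hε hγ b c (ΨK b) (ΨK c) (hA4 b) (hA4 c) V hVb K hK hKs
    simp only [hA3] at hG
    rw [hind c (ΨK b), hind b (ΨK c)] at hG
    rw [hG]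
  refine ⟨Ψ, ΨK, M, N, hA1, hA2, hA3, hA4, hA5, hA6, hB1, hB2, hB3, hB4, hB5, hC1, hC2, hC3, hC4, hC5, hTsym, fun b c => ?_⟩
  -- `N_Kᵗ` is a decaying left inverse of `T_K`; uniqueness
  have hK1 : 0 < (2 * (1 - exp (-(δ₁ - ν)))⁻¹) ^ d := K_pos (d := d) (sub_pos.2 hνδ)
  have hCN : 0 ≤ 2 * (c₁ * exp (ν * d) * (2 * (1 - exp (-(δ₁ - ν)))⁻¹) ^ d) := by positivity
  have hNt : ∀ b c, |N c b| ≤ 2 * (c₁ * exp (ν * d) * (2 * (1 - exp (-(δ₁ - ν)))⁻¹) ^ d)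
      * exp (-(ν * ∑ i, (((b i - c i).natAbs : ℕ) : ℝ))) := fun b c => by rw [natAbs_sub_comm_sum]; exact hC1 c b
  have hleft : ∀ b c, ∑' b' : X d, N b' b * ((((n : ℝ) + 1) ^ d)⁻¹ * ∑ q ∈ B n b', ΨK c q) = if b = c then 1 else 0 := by
    intro b c
    have h := (hC2 c b).2
    have e : (fun b' : X d => N b' b * ((((n : ℝ) + 1) ^ d)⁻¹ * ∑ q ∈ B n b', ΨK c q))
        = fun b' => ((((n : ℝ) + 1) ^ d)⁻¹ * ∑ q ∈ B n c, ΨK b' q) * N b' b := funext fun b' => by rw [hTsym b' c, mul_comm]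
    rw [e, h]
    by_cases hbc : b = c
    · rw [if_pos hbc, if_pos hbc.symm]
    · rw [if_neg hbc, if_neg (fun h' => hbc h'.symm)]
  exact ((hC5 (fun b c => N c b) _ ν hCN hν hNt).2 hleft b c).symm

/-! ## §2. Toy -/

/-- Toy (`d = 3`, `a = 1`, `λ = 0`, `Λ = 1`): the five constants exist. -/
example : ∃ C₀ CP δ₀ c₁ δ₁ : ℝ, 0 < C₀ ∧ 0 < CP ∧ 0 < δ₀ ∧ 0 < c₁ ∧ 0 < δ₁ :=
  let ⟨C₀, CP, δ₀, c₁, δ₁, h1, h2, h3, h4, h5, _⟩ :=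
    zd_perturbed_symmetric (d := 3) le_rfl 1 one_pos (lam := 0) (Lam := 1)
      (by rw [min_eq_right (by norm_num : (1 : ℝ) ≤ 2)]; norm_num) zero_le_one
  ⟨C₀, CP, δ₀, c₁, δ₁, h1, h2, h3, h4, h5⟩

end Summit.QuantumFields.BalabanUV.T4Continuum.NE7b.SupZdPerturbedSymmetric
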